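/-
Copyright (c) 2026. All rights reserved.
Released under Apache 2.0 license as described in the file LICENSE.
Authors: abc-iut cell, seat abc-iut-L4-t9 (gen 3; block W2-B2, model of [AbsTopIII] Cor 3.7).
-/
import Literature.AnabelianGeometry.AbsoluteAnabelian.MLFGaloisCategories
import Mathlib.NumberTheory.Padics.Complex
import Mathlib.Topology.Algebra.ContinuousMonoidHom
import Mathlib.CategoryTheory.Functor.Basic
import HarnessLib

/-!
# [AbsTopIII] Def 3.1 (iii): the MODEL categories `𝒳 = 𝒞^MLF_TF`, `𝔈 = 𝒯𝔾`, `𝒩 = 𝒞^MLF_TS`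
# (Galois-isomorphism versions) realised on `ℚ̄_p`, and the functors `(Π ↷ M) ↦ Π`

S. Mochizuki, *Topics in absolute anabelian geometry III*, J. Math. Sci. Univ. Tokyo 22 (2015)
[MochizukiAbsTopIII2015]; locators = pages of the kurims manuscript (`paper:url-5493eb38cbb7`), read on
the page (Def 3.1 (i)–(iii) pp. 66–68; Cor 3.6 p. 78; Cor 3.7 p. 86).

Def 3.1 (iii) p. 67–68: "Write `𝒞^MLF_T` for the category whose objects are the MLF-Galois `T`-pairs and
whose morphisms are the morphisms of MLF-Galois `T`-pairs. Also, we shall use the same notation, except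
with `𝒞` replaced by [underlined / double-underlined variants] to denote the various subcategories
determined by the `T`-isomorphisms (respectively, Galois-isomorphisms; isomorphisms) [...] Finally, we
shall write `𝒯𝔾` for the category of topological groups and continuous homomorphisms [...] also, we
shall use the same notation, except with `TG` replaced by [double-underlined `TG`] to denote the various
subcategories determined by the isomorphisms. Thus, for `T ∈ {TF, TCG, TLG, TM, TS, TS⊞}`, the
assignment `(Π ↷ M) ↦ Π` determines various compatible natural functors `𝒞^MLF_T → 𝒯𝔾` [as well as
double underlined versions of these functors]."  Cor 3.6 p. 79 / Cor 3.7 p. 86 use "the evident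
[double-underlined/overlined] restrictions" of `log`, `λ^×`, `λ^{×pf}`, i.e. the Galois-isomorphism
subcategories (the arrow `κ_An : 𝔈 → Anab` of Cor 3.6 is an equivalence onto a category whose morphisms
"are the morphisms induced by isomorphisms of `𝒯𝔾_sB`", Def 3.1 (vi) p. 70, which forces this reading).

## What this file builds (real constructions; abc-iut-L4-t2's Def 3.1 vocabulary re-used, not re-declared)

* `TopGroupObj` + its groupoid structure: **double-underlined `𝒯𝔾`** — topological groups and
  isomorphisms of topological groups (`≃ₜ*`).  (Mathlib has `ProfiniteGrp` but no category of general
  topological groups; abc-iut-L4-t2's `ModelMLFGaloisData.Pi` is an arbitrary topological group.)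
* `TFModel p` + its category structure: the **MODEL MLF-Galois `TF`-pairs of residue characteristic `p`
  realised on the fixed algebraic closure `k̄ = ℚ̄_p`** (`PadicAlgCl p`): objects = abc-iut-L4-t2's model
  data `ModelMLFGaloisData k ℚ̄_p` (Def 3.1 (i): "`Π_k`, equipped with a continuous surjection
  `ε_k : Π_k ↠ G_k`") over a base `ℚ_p ⊆ k ⊆ ℚ̄_p` finite over `ℚ_p`; morphisms = abc-iut-L4-t2's
  morphisms of pairs `GaloisFieldPair.Hom` (Def 3.1 (ii)) between the associated pairs `(Π_k ↷ ℚ̄_p)`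
  that are **Galois-isomorphisms** (`φ_Π` bijective and open).  Every MLF-Galois `TF`-pair of residue
  characteristic `p` is isomorphic to the pair of such an object (Def 3.1 (ii) + any MLF of residue
  characteristic `p` embeds in `ℚ̄_p`: abc-iut-L6-d2's `MLFClosure.galoisPadicLog` chain), and pairs of
  different residue characteristics admit no morphisms (abc-iut-L4 `PadicEmbeddingRigidity`), so this
  is — up to equivalence, prime by prime — the double-underlined `𝒞^MLF_TF`; the "strictly Belyi type"
  restriction `𝒞^{MLF-sB}` (a condition on `Π_k ↠ G_k`, plan/FOUNDATIONS.md row 12) is not imposed.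
* `TSObj` + its category structure: **double-underlined `𝒞_TS`-shaped pairs** — objects abc-iut-L4-t2's
  `GaloisSpacePair` (Def 3.1 (i)/(ii) for `T = TS`), morphisms = continuous equivariant maps of spaces
  over Galois-isomorphisms of topological groups inducing a map of arithmetic Galois groups
  (`comap_ker`, the kernel form used by abc-iut-L4-t2 for `TF/TM`).
* The functors "`(Π ↷ M) ↦ Π`": `TFModel.gal : TFModel p ⥤ TopGroupObj`, `TSObj.gal : TSObj ⥤ TopGroupObj`.

All categories are `Category.{1}` on types in `Type 1` (objects and morphisms in ONE universe), which is
the shape required by abc-iut-L4-t2's `DiagramOfCategories.{u,u,0}` / the `BiAnabelianSetting` discharge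
files of Cor 3.7 (`{X E N : Type u} [Category.{u} X]`).  Continued in `MLFLogFrobeniusFunctors.lean`
(`log`, `λ^×`, `λ^{×pf}`, `ι_log`, `ι_×`, the model `BiAnabelianSetting`).  HONEST FRAMING: refereed
pre-IUT material; a MODEL (kernel definitions), not a discharge of any reconstruction claim; nothing here
bears on [IUTchIII] Cor. 3.12.
-/

set_option autoImplicit false

noncomputable section

namespace Literature.AnabelianGeometry.AbsoluteAnabelian.AbsTopIII

open CategoryTheory

/-! ## `𝔈`: double-underlined `𝒯𝔾` — topological groups and their isomorphisms -/

/-- An object of `𝒯𝔾`: "the category of topological groups" (Def 3.1 (iii) p. 68), bundled.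
[cite: MochizukiAbsTopIII2015, Definition 3.1 (iii) p.68] -/
structure TopGroupObj : Type 1 where
  /-- The underlying topological group. -/
  G : Type
  [instGroup : Group G]
  [instTop : TopologicalSpace G]
  [instTopGroup : IsTopologicalGroup G]

attribute [instance] TopGroupObj.instGroup TopGroupObj.instTop TopGroupObj.instTopGroup

namespace TopGroupObj

/-- A morphism of double-underlined `𝒯𝔾`: an isomorphism of topological groups ("the various
subcategories determined by the isomorphisms", Def 3.1 (iii) p. 68).
[cite: MochizukiAbsTopIII2015, Definition 3.1 (iii) p.68] -/
structure Hom (A B : TopGroupObj) : Type 1 where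
  /-- The isomorphism of topological groups. -/
  iso : A.G ≃ₜ* B.G

/-- Two morphisms agree iff their isomorphisms agree pointwise.
[cite: MochizukiAbsTopIII2015, Definition 3.1 (iii) p.68] -/
@[ext]
theorem Hom.ext {A B : TopGroupObj} {f g : Hom A B} (h : ∀ x, f.iso x = g.iso x) : f = g := by
  cases f; cases g; congr; exact ContinuousMulEquiv.ext h

/-- **Double-underlined `𝒯𝔾`** as a category (a groupoid: composition of isomorphisms of topological
groups). [cite: MochizukiAbsTopIII2015, Definition 3.1 (iii) p.68] -/
instance category : Category.{1} TopGroupObj where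
  Hom A B := Hom A B
  id A := ⟨ContinuousMulEquiv.refl A.G⟩
  comp f g := ⟨f.iso.trans g.iso⟩
  id_comp f := by ext; rfl
  comp_id f := by ext; rfl
  assoc f g h := by ext; rfl

/-- The isomorphism underlying an identity morphism is the identity.
[cite: MochizukiAbsTopIII2015, Definition 3.1 (iii) p.68] -/
@[simp] theorem id_iso_apply (A : TopGroupObj) (x : A.G) : (𝟙 A : Hom A A).iso x = x := rfl

/-- Composition is composition of the underlying isomorphisms.
[cite: MochizukiAbsTopIII2015, Definition 3.1 (iii) p.68] -/
@[simp] theorem comp_iso_apply {A B C : TopGroupObj} (f : A ⟶ B) (g : B ⟶ C) (x : A.G) :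
    (f ≫ g : Hom A C).iso x = g.iso (f.iso x) := rfl

/-- Every morphism of double-underlined `𝒯𝔾` is an isomorphism (it is a groupoid).
[cite: MochizukiAbsTopIII2015, Definition 3.1 (iii) p.68] -/
def isoOfHom {A B : TopGroupObj} (f : A ⟶ B) : A ≅ B where
  hom := f
  inv := ⟨(f : Hom A B).iso.symm⟩
  hom_inv_id := Hom.ext fun x => (f : Hom A B).iso.symm_apply_apply x
  inv_hom_id := Hom.ext fun x => (f : Hom A B).iso.apply_symm_apply x

end TopGroupObj

/-! ## `𝒳`: model MLF-Galois `TF`-pairs of residue characteristic `p` on `ℚ̄_p`, Galois-isomorphisms -/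

variable (p : ℕ) [Fact p.Prime]

/-- An object of the MODEL category `𝒳`: model data of Def 3.1 (i) — "let `k` be an MLF, `k̄` an
algebraic closure of `k`, `G_k := Gal(k̄/k)` [...] Let `Π_k` be a topological group, equipped with a
continuous surjection `ϵ_k : Π_k ↠ G_k`" — with `k̄ := ℚ̄_p` FIXED and `k` a subfield of `ℚ̄_p` finite
over `ℚ_p` (abc-iut-L4-t2's `ModelMLFGaloisData k ℚ̄_p` verbatim for `Π_k ↠ G_k`).
[cite: MochizukiAbsTopIII2015, Definition 3.1 (i) p.66] -/
structure TFModel : Type 1 where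
  /-- The MLF `k`, `ℚ_p ⊆ k ⊆ ℚ̄_p`. -/
  k : IntermediateField ℚ_[p] (PadicAlgCl p)
  [instFinite : FiniteDimensional ℚ_[p] k]
  /-- `Π_k` with its continuous surjection `ε_k : Π_k ↠ G_k = Gal(ℚ̄_p/k)`. -/
  D : ModelMLFGaloisData k (PadicAlgCl p)

attribute [instance] TFModel.instFinite

namespace TFModel

variable {p}

/-- `ℚ̄_p` is algebraic over the base `k` of a model object (tower `ℚ_p ⊆ k ⊆ ℚ̄_p`).
[cite: MochizukiAbsTopIII2015, Definition 3.1 (i) p.66] -/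
theorem isAlgebraic (A : TFModel p) : Algebra.IsAlgebraic A.k (PadicAlgCl p) :=
  Algebra.IsAlgebraic.tower_top (K := ℚ_[p]) A.k

/-- The model MLF-Galois `TF`-pair `(Π_k ↷ k̄ = ℚ̄_p)` of a model object (abc-iut-L4-t2's
`ModelMLFGaloisData.fieldPair`: `Π_k` acting on `ℚ̄_p` through `ε_k`).
[cite: MochizukiAbsTopIII2015, Definition 3.1 (i) p.67] -/
def pair (A : TFModel p) : GaloisFieldPair.{0} :=
  haveI := A.isAlgebraic
  A.D.fieldPair

/-- The Galois group of the pair of `A` is `Π_k`. [cite: MochizukiAbsTopIII2015, Definition 3.1 (i) p.67] -/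
@[simp] theorem pair_Pi (A : TFModel p) : A.pair.Pi = A.D.Pi := rfl

/-- The arithmetic datum of the pair of `A` is `k̄ = ℚ̄_p`. [cite: MochizukiAbsTopIII2015, Definition 3.1 (i) p.67] -/
@[simp] theorem pair_M (A : TFModel p) : A.pair.M = PadicAlgCl p := rfl

/-- The action of `g ∈ Π_k` on `x ∈ ℚ̄_p` is `ε_k(g)(x)`. [cite: MochizukiAbsTopIII2015, Definition 3.1 (i) p.67] -/
theorem pair_smul (A : TFModel p) (g : A.pair.Pi) (x : A.pair.M) :
    g • x = (A.D.aug g : PadicAlgCl p ≃ₐ[A.k] PadicAlgCl p) (show PadicAlgCl p from x) := rfl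

/-- A morphism of the MODEL category `𝒳`: a morphism of MLF-Galois `TF`-pairs (Def 3.1 (ii): "a
morphism of objects `φ_M : M₁ → M₂` of `T`, together with a compatible continuous homomorphism
`φ_Π : Π₁ → Π₂` that induces an open injective homomorphism between the respective arithmetic Galois
groups" — abc-iut-L4-t2's `GaloisFieldPair.Hom`) which is a **Galois-isomorphism** ("if `φ_Π` is an
isomorphism" of topological groups: bijective and open). [cite: MochizukiAbsTopIII2015, Definition 3.1 (ii) p.67] -/
structure Hom (A B : TFModel p) : Type 1 where
  /-- The underlying morphism of MLF-Galois `TF`-pairs. -/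
  hom : GaloisFieldPair.Hom A.pair B.pair
  /-- `φ_Π` is bijective ... -/
  bijective : Function.Bijective hom.homPi
  /-- ... and open, i.e. an isomorphism of topological groups. -/
  isOpenMap : IsOpenMap hom.homPi

/-- Two morphisms agree iff their underlying morphisms of pairs agree.
[cite: MochizukiAbsTopIII2015, Definition 3.1 (ii) p.67] -/
@[ext]
theorem Hom.ext {A B : TFModel p} {f g : Hom A B} (h : f.hom = g.hom) : f = g := by
  cases f; cases g; congr

/-- The underlying morphism of a `Hom` is a Galois-isomorphism in abc-iut-L4-t2's sense.
[cite: MochizukiAbsTopIII2015, Definition 3.1 (ii) p.67] -/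
theorem Hom.isGaloisIso {A B : TFModel p} (f : Hom A B) : f.hom.IsGaloisIso :=
  ⟨f.bijective, f.isOpenMap⟩

/-- **The model category `𝒳`** (double-underlined `𝒞^MLF_TF`, residue characteristic `p`, on `ℚ̄_p`):
composition and identities are those of abc-iut-L4-t2's category of pairs.
[cite: MochizukiAbsTopIII2015, Definition 3.1 (iii) p.67] -/
instance category : Category.{1} (TFModel p) where
  Hom A B := Hom A B
  id A := ⟨GaloisFieldPair.Hom.id A.pair, Function.bijective_id, IsOpenMap.id⟩
  comp f g := ⟨GaloisFieldPair.Hom.comp f.hom g.hom, g.bijective.comp f.bijective,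
    g.isOpenMap.comp f.isOpenMap⟩
  id_comp f := by ext <;> rfl
  comp_id f := by ext <;> rfl
  assoc f g h := by ext <;> rfl

/-- The underlying pair-morphism of an identity. [cite: MochizukiAbsTopIII2015, Definition 3.1 (iii) p.67] -/
@[simp] theorem id_hom (A : TFModel p) : (𝟙 A : Hom A A).hom = GaloisFieldPair.Hom.id A.pair := rfl

/-- The underlying pair-morphism of a composite. [cite: MochizukiAbsTopIII2015, Definition 3.1 (iii) p.67] -/
@[simp] theorem comp_hom {A B C : TFModel p} (f : A ⟶ B) (g : B ⟶ C) :
    (f ≫ g : Hom A C).hom = GaloisFieldPair.Hom.comp (f : Hom A B).hom (g : Hom B C).hom := rfl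

/-- `φ_Π` of an identity is the identity. [cite: MochizukiAbsTopIII2015, Definition 3.1 (iii) p.67] -/
@[simp] theorem id_homPi_apply (A : TFModel p) (g : A.pair.Pi) : (𝟙 A : Hom A A).hom.homPi g = g := rfl

/-- `φ_M` of an identity is the identity. [cite: MochizukiAbsTopIII2015, Definition 3.1 (iii) p.67] -/
@[simp] theorem id_homM_apply (A : TFModel p) (x : A.pair.M) : (𝟙 A : Hom A A).hom.homM x = x := rfl

/-- `φ_Π` of a composite. [cite: MochizukiAbsTopIII2015, Definition 3.1 (iii) p.67] -/
@[simp] theorem comp_homPi_apply {A B C : TFModel p} (f : A ⟶ B) (g : B ⟶ C) (x : A.pair.Pi) :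
    (f ≫ g : Hom A C).hom.homPi x = (g : Hom B C).hom.homPi ((f : Hom A B).hom.homPi x) := rfl

/-- `φ_M` of a composite. [cite: MochizukiAbsTopIII2015, Definition 3.1 (iii) p.67] -/
@[simp] theorem comp_homM_apply {A B C : TFModel p} (f : A ⟶ B) (g : B ⟶ C) (x : A.pair.M) :
    (f ≫ g : Hom A C).hom.homM x = (g : Hom B C).hom.homM ((f : Hom A B).hom.homM x) := rfl

/-- The isomorphism of topological groups `φ_Π : Π₁ ⥲ Π₂` underlying a Galois-isomorphism (a bijective,
continuous and open homomorphism is an isomorphism of topological groups).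
[cite: MochizukiAbsTopIII2015, Definition 3.1 (ii) p.67] -/
def Hom.piIso {A B : TFModel p} (f : Hom A B) : A.pair.Pi ≃ₜ* B.pair.Pi :=
  ContinuousMulEquiv.mk'
    ((Equiv.ofBijective f.hom.homPi f.bijective).toHomeomorphOfContinuousOpen
      f.hom.continuous_homPi f.isOpenMap)
    (fun x y => map_mul f.hom.homPi x y)

/-- `piIso` is `φ_Π` as a function. [cite: MochizukiAbsTopIII2015, Definition 3.1 (ii) p.67] -/
@[simp] theorem Hom.piIso_apply {A B : TFModel p} (f : Hom A B) (x : A.pair.Pi) :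
    f.piIso x = f.hom.homPi x := rfl

variable (p) in
/-- **The functor "`(Π ↷ M) ↦ Π`"** `𝒳 → 𝔈` (double-underlined version): a model pair goes to its
Galois group `Π_k`, a Galois-isomorphism to `φ_Π`. This is the arrow `gal` of the Cor 3.7 setting
(`BiAnabelianSetting.gal`). [cite: MochizukiAbsTopIII2015, Definition 3.1 (iii) p.68] -/
def gal : TFModel p ⥤ TopGroupObj where
  obj A := ⟨A.pair.Pi⟩
  map f := ⟨(f : Hom _ _).piIso⟩
  map_id _ := TopGroupObj.Hom.ext fun _ => rfl
  map_comp _ _ := TopGroupObj.Hom.ext fun _ => rfl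

/-- `gal` on objects is `Π_k`. [cite: MochizukiAbsTopIII2015, Definition 3.1 (iii) p.68] -/
@[simp] theorem gal_obj_G (A : TFModel p) : ((gal p).obj A).G = A.pair.Pi := rfl

/-- `gal` on morphisms is `φ_Π`. [cite: MochizukiAbsTopIII2015, Definition 3.1 (iii) p.68] -/
@[simp] theorem gal_map_iso_apply {A B : TFModel p} (f : A ⟶ B) (x : A.pair.Pi) :
    ((gal p).map f).iso x = (f : Hom A B).hom.homPi x := rfl

end TFModel

/-! ## `𝒩`: `TS`-pairs and their Galois-isomorphisms -/

/-- An object of the MODEL category `𝒩` (double-underlined `𝒞_TS`-shaped pairs): abc-iut-L4-t2's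
`GaloisSpacePair` — "a topological group `Π`", an (ind-)locally compact space `M`, "and a continuous
action of `Π` on `M`" (Def 3.1 (i)/(ii) for `T = TS`), wrapped so that the category structure below
lives on a type of this file. [cite: MochizukiAbsTopIII2015, Definition 3.1 (ii) p.67] -/
structure TSObj : Type 1 where
  /-- The underlying `TS`-pair `(Π ↷ M)`. -/
  pair : GaloisSpacePair.{0}

namespace TSObj

/-- The arithmetic Galois group of a `TS`-pair in kernel form: the kernel of `Π → Aut(M)` ("the
surjection `Π ↠ G` determined by the action of `Π` on `M`", Def 3.1 (ii); abc-iut-L4-t2's `actionKer`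
for `TF/TM`, here for spaces). [cite: MochizukiAbsTopIII2015, Definition 3.1 (ii) p.67] -/
def actionKer (P : TSObj) : Subgroup P.pair.Pi := (MulAction.toPermHom P.pair.Pi P.pair.M).ker

/-- Membership in the kernel: `g` acts trivially on `M`. [cite: MochizukiAbsTopIII2015, Definition 3.1 (ii) p.67] -/
theorem mem_actionKer_iff (P : TSObj) (g : P.pair.Pi) : g ∈ P.actionKer ↔ ∀ x : P.pair.M, g • x = x := by
  rw [actionKer, MonoidHom.mem_ker, Equiv.ext_iff]
  rfl

/-- A morphism of the MODEL category `𝒩`: a morphism of `TS`-pairs (Def 3.1 (ii): "a morphism of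
objects `φ_M : M₁ → M₂` of `T`" — a continuous map — "together with a compatible continuous homomorphism
`φ_Π : Π₁ → Π₂` that induces an [open injective] homomorphism between the respective arithmetic Galois
groups") which is a Galois-isomorphism (`φ_Π` bijective and open; the induced map on arithmetic Galois
groups is then automatically an isomorphism of topological groups, so only "induces" = `comap_ker` is
recorded). [cite: MochizukiAbsTopIII2015, Definition 3.1 (ii) p.67] -/
structure Hom (P Q : TSObj) : Type 1 where
  /-- `φ_Π`. -/
  homPi : P.pair.Pi →* Q.pair.Pi
  continuous_homPi : Continuous homPi
  bijective_homPi : Function.Bijective homPi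
  isOpenMap_homPi : IsOpenMap homPi
  /-- `φ_M`, a morphism of `TS` (continuous map). -/
  homM : P.pair.M → Q.pair.M
  continuous_homM : Continuous homM
  /-- Compatibility with the actions. -/
  smul_comm : ∀ (g : P.pair.Pi) (x : P.pair.M), homM (g • x) = homPi g • homM x
  /-- `φ_Π` induces a homomorphism of arithmetic Galois groups (kernel form). -/
  comap_ker : Q.actionKer.comap homPi = P.actionKer

/-- Two morphisms agree iff `φ_Π` and `φ_M` agree. [cite: MochizukiAbsTopIII2015, Definition 3.1 (ii) p.67] -/
@[ext]
theorem Hom.ext {P Q : TSObj} {f g : Hom P Q} (hPi : f.homPi = g.homPi) (hM : f.homM = g.homM) :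
    f = g := by
  cases f; cases g; congr

/-- The identity morphism of a `TS`-pair. [cite: MochizukiAbsTopIII2015, Definition 3.1 (iii) p.67] -/
def Hom.id (P : TSObj) : Hom P P where
  homPi := MonoidHom.id _
  continuous_homPi := continuous_id
  bijective_homPi := Function.bijective_id
  isOpenMap_homPi := IsOpenMap.id
  homM := _root_.id
  continuous_homM := continuous_id
  smul_comm _ _ := rfl
  comap_ker := Subgroup.comap_id _

/-- Composition of morphisms of `TS`-pairs. [cite: MochizukiAbsTopIII2015, Definition 3.1 (iii) p.67] -/
def Hom.comp {P Q R : TSObj} (φ : Hom P Q) (ψ : Hom Q R) : Hom P R where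
  homPi := ψ.homPi.comp φ.homPi
  continuous_homPi := ψ.continuous_homPi.comp φ.continuous_homPi
  bijective_homPi := ψ.bijective_homPi.comp φ.bijective_homPi
  isOpenMap_homPi := ψ.isOpenMap_homPi.comp φ.isOpenMap_homPi
  homM := ψ.homM ∘ φ.homM
  continuous_homM := ψ.continuous_homM.comp φ.continuous_homM
  smul_comm g x := by simp [φ.smul_comm, ψ.smul_comm]
  comap_ker := by rw [← Subgroup.comap_comap, ψ.comap_ker, φ.comap_ker]

/-- **The model category `𝒩`** (double-underlined `𝒞_TS`-shaped pairs).
[cite: MochizukiAbsTopIII2015, Definition 3.1 (iii) p.67] -/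
instance category : Category.{1} TSObj where
  Hom P Q := Hom P Q
  id P := Hom.id P
  comp φ ψ := Hom.comp φ ψ
  id_comp φ := by ext <;> rfl
  comp_id φ := by ext <;> rfl
  assoc φ ψ χ := by ext <;> rfl

/-- `φ_Π` of an identity. [cite: MochizukiAbsTopIII2015, Definition 3.1 (iii) p.67] -/
@[simp] theorem id_homPi_apply (P : TSObj) (g : P.pair.Pi) : (𝟙 P : Hom P P).homPi g = g := rfl

/-- `φ_M` of an identity. [cite: MochizukiAbsTopIII2015, Definition 3.1 (iii) p.67] -/
@[simp] theorem id_homM_apply (P : TSObj) (x : P.pair.M) : (𝟙 P : Hom P P).homM x = x := rfl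

/-- `φ_Π` of a composite. [cite: MochizukiAbsTopIII2015, Definition 3.1 (iii) p.67] -/
@[simp] theorem comp_homPi_apply {P Q R : TSObj} (φ : P ⟶ Q) (ψ : Q ⟶ R) (g : P.pair.Pi) :
    (φ ≫ ψ : Hom P R).homPi g = (ψ : Hom Q R).homPi ((φ : Hom P Q).homPi g) := rfl

/-- `φ_M` of a composite. [cite: MochizukiAbsTopIII2015, Definition 3.1 (iii) p.67] -/
@[simp] theorem comp_homM_apply {P Q R : TSObj} (φ : P ⟶ Q) (ψ : Q ⟶ R) (x : P.pair.M) :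
    (φ ≫ ψ : Hom P R).homM x = (ψ : Hom Q R).homM ((φ : Hom P Q).homM x) := rfl

/-- The isomorphism of topological groups `φ_Π` underlying a Galois-isomorphism of `TS`-pairs.
[cite: MochizukiAbsTopIII2015, Definition 3.1 (ii) p.67] -/
def Hom.piIso {P Q : TSObj} (f : Hom P Q) : P.pair.Pi ≃ₜ* Q.pair.Pi :=
  ContinuousMulEquiv.mk'
    ((Equiv.ofBijective f.homPi f.bijective_homPi).toHomeomorphOfContinuousOpen
      f.continuous_homPi f.isOpenMap_homPi)
    (fun x y => map_mul f.homPi x y)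

/-- `piIso` is `φ_Π` as a function. [cite: MochizukiAbsTopIII2015, Definition 3.1 (ii) p.67] -/
@[simp] theorem Hom.piIso_apply {P Q : TSObj} (f : Hom P Q) (x : P.pair.Pi) : f.piIso x = f.homPi x :=
  rfl

/-- **The functor "`(Π ↷ M) ↦ Π`"** `𝒩 → 𝔈` (double-underlined version; the arrow `𝒩 → 𝔈` of the
diagrams `𝒟`, `𝒟†` of Cor 3.6 / 3.7, `BiAnabelianSetting.spaceGal`).
[cite: MochizukiAbsTopIII2015, Definition 3.1 (iii) p.68] -/
def gal : TSObj ⥤ TopGroupObj where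
  obj P := ⟨P.pair.Pi⟩
  map f := ⟨(f : Hom _ _).piIso⟩
  map_id _ := TopGroupObj.Hom.ext fun _ => rfl
  map_comp _ _ := TopGroupObj.Hom.ext fun _ => rfl

/-- `gal` on objects is `Π`. [cite: MochizukiAbsTopIII2015, Definition 3.1 (iii) p.68] -/
@[simp] theorem gal_obj_G (P : TSObj) : (gal.obj P).G = P.pair.Pi := rfl

/-- `gal` on morphisms is `φ_Π`. [cite: MochizukiAbsTopIII2015, Definition 3.1 (iii) p.68] -/
@[simp] theorem gal_map_iso_apply {P Q : TSObj} (f : P ⟶ Q) (x : P.pair.Pi) :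
    (gal.map f).iso x = (f : Hom P Q).homPi x := rfl

end TSObj

end Literature.AnabelianGeometry.AbsoluteAnabelian.AbsTopIII

end
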